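import Literature.NumberTheory.LFunctions.ExplicitPNTNonExceptionalModuli
import Literature.NumberTheory.Sieve.BombieriFriedlanderIwaniecProofs
import HarnessLib

/-!
# Explicit `θ(x; q, a)` bounds and an explicit bound for the least prime in every progression to a
# non-exceptional modulus `10⁵ ≤ q ≤ Q` (Bennett–Martin–O'Bryant–Rechnitzer 2018, Lemma 6.12, `θ`-part)

Topic `Literature/NumberTheory/LFunctions`; namespace `Literature.NumberTheory.LFunctions.BMOR2018`
(continuing `ExplicitPNTNonExceptionalModuli.lean`, which types the `ψ`-part of Lemma 6.12). ONE named
fact AS PRINTED (`lemma612_theta`, D-0014, not discharged) and THEOREMS.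

## What the source prints

M. A. Bennett, G. Martin, K. O'Bryant, A. Rechnitzer, Illinois J. Math. 62 (2018) 427–532 =
arXiv:1802.00085 (held), **Lemma 6.12**: "For `q ≥ 10⁵` and `x ≥ e^{4R₁ log² q}`, … and
`|θ(x; q, a) − x/φ(q)| ≤ (1.012/φ(q)) x^{1−40/(√q log² q)} + 1.4579 x √(log x/R₁) exp(−√(log x/R₁)) + 1.001 √x`,
where the first term on each right-hand side is present only if an exceptional zero exists for a
quadratic `L`-function with conductor `q`." (`gcd(a, q) = 1`; `θ(x; q, a) = ∑_{p ≤ x, p ≡ a (q)} log p`;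
exceptional zero per Definition 6.1: a real zero `β` with `β ≥ 1 − 1/(R₁ log q)`, `R₁ = 9.645908801`.)

## Contents

* `BMOR2018.lemma612_theta` — **named fact**, the `θ`-part of Lemma 6.12 as printed (both clauses),
  with `θ(x; q, a)` the tree's `Literature.NumberTheory.Sieve.BFIReduction.thetaMod q a x`.
* `BMOR2018.theta_bound_of_noExceptionalZeroUpTo` — under a table `NoExceptionalZeroUpTo Q c₀` with
  `1/R₁ ≤ c₀`: for `10⁵ ≤ q ≤ Q`, units `a`, `x ≥ exp(4R₁ log² q)`:
  `|θ(x; q, a) − x/φ(q)| ≤ errTerm x + 1.001 √x`, and `theta_lower_bound_…`: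
  `θ(x; q, a) ≥ x/φ(q) − x/(5 log² x) − 1.001 √x` (Lemma 6.14 in the kernel, `Z = 2`).
* **The least prime in a progression, explicitly, over the certified range**:
  `BMOR2018.theta_pos_of_noExceptionalZeroUpTo` — `θ(x; q, a) > 0` for every
  `x ≥ exp(max(4R₁ log² q, √q))`, and `BMOR2018.exists_prime_le_of_noExceptionalZeroUpTo` — **for every
  modulus `10⁵ ≤ q ≤ Q` and every reduced class `a` there is a prime `p ≡ a (mod q)` with
  `p ≤ exp(max(4R₁ log² q, √q))`** (`4R₁ = 38.583635204`), conditional on the two named facts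
  (`lemma612_theta`; the table). Instances over Platt's range (`platt2016_theorem71`).

WHAT THIS IS NOT: not Linnik's theorem (`p ≪ q^L`): the bound is `exp(O(log² q + √q))`, the price of
using only the zero-free region with no zero-density input; not valid for `q > Q` or `q < 10⁵`.

## References

* M. A. Bennett, G. Martin, K. O'Bryant, A. Rechnitzer, Illinois J. Math. 62 (2018) 427–532,
  Definition 6.1, Lemmas 6.12 and 6.14. [BennettMartinOBryantRechnitzer2018]
* K. S. McCurley, J. Number Theory 19 (1984) 7–32, Theorem 1 and p. 8 ("sharp explicit numerical bounds
  for … `θ(x; k, l)`" for nonexceptional moduli). [McCurley1984ZFR]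
-/

noncomputable section

open Complex Finset Literature.Barriers.Parity
open Literature.NumberTheory.Sieve.BFIReduction

namespace Literature.NumberTheory.LFunctions

namespace BMOR2018

/-! ### The named fact -/

/-- **Bennett–Martin–O'Bryant–Rechnitzer 2018, Lemma 6.12, `θ`-part (as printed): "For `q ≥ 10⁵` and
`x ≥ e^{4R₁ log² q}`, …
`|θ(x; q, a) − x/φ(q)| ≤ (1.012/φ(q)) x^{1−40/(√q log² q)} + 1.4579 x √(log x/R₁) exp(−√(log x/R₁)) + 1.001 √x`,
where the first term on each right-hand side is present only if an exceptional zero exists for a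
quadratic `L`-function with conductor `q`."** Rendering as for the `ψ`-part (`lemma612_psi`): `a` a unit
of `ZMod q`; `θ(x; q, a) = BFIReduction.thetaMod q a x = ∑_{p ≤ x, p ≡ a (q)} log p`; first clause the
three-term bound, second clause the two-term bound under "no quadratic `χ` mod `q` (principal included —
a harmless strengthening of the hypothesis) has a real zero `β` with `1 − 1/(R₁ log q) ≤ β < 1`". Not
discharged here (McCurley's explicit method, §6.2 of the source, size L).
[cite: BennettMartinOBryantRechnitzer2018, Lemma 6.12] -/
def lemma612_theta : Prop :=
  ∀ (q : ℕ) [NeZero q], 10 ^ 5 ≤ q → ∀ (a : (ZMod q)ˣ) (x : ℝ),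
    Real.exp (4 * R₁ * Real.log q ^ 2) ≤ x →
      |thetaMod q (a : ZMod q) x - x / q.totient| ≤
          1.012 / q.totient * x ^ (1 - 40 / (Real.sqrt q * Real.log q ^ 2)) + errTerm x +
            1.001 * Real.sqrt x ∧
      ((∀ χ : DirichletCharacter ℂ q, χ.IsQuadratic →
          ∀ β : ℝ, 1 - 1 / (R₁ * Real.log q) ≤ β → β < 1 → χ.LFunction β ≠ 0) →
        |thetaMod q (a : ZMod q) x - x / q.totient| ≤ errTerm x + 1.001 * Real.sqrt x)

/-! ### The `θ` consumer -/

/-- **Explicit `θ` bound over the table.** Under `lemma612_theta` and `NoExceptionalZeroUpTo Q c₀` with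
`1/R₁ ≤ c₀`: for every modulus `10⁵ ≤ q ≤ Q`, every unit `a` mod `q` and every `x ≥ exp(4R₁ log² q)`,
`|θ(x; q, a) − x/φ(q)| ≤ 1.4579 x √(log x/R₁) e^{−√(log x/R₁)} + 1.001 √x`.
[cite: BennettMartinOBryantRechnitzer2018, Lemma 6.12] -/
theorem theta_bound_of_noExceptionalZeroUpTo (h612 : lemma612_theta) {Q : ℕ} {c₀ : ℝ}
    (hN : NoExceptionalZeroUpTo Q c₀) (hc : 1 / R₁ ≤ c₀) {q : ℕ} [NeZero q] (hq : 10 ^ 5 ≤ q)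
    (hqQ : q ≤ Q) (a : (ZMod q)ˣ) {x : ℝ} (hx : Real.exp (4 * R₁ * Real.log q ^ 2) ≤ x) :
    |thetaMod q (a : ZMod q) x - x / q.totient| ≤ errTerm x + 1.001 * Real.sqrt x :=
  (h612 q hq a x hx).2 fun χ hquad _ hβ hβ1 ↦
    nonexceptional_of_noExceptionalZeroUpTo hN hc hq hqQ χ hquad hβ hβ1

/-- **Explicit lower bound for `θ(x; q, a)` over the table** (log-power form, `Z = 2`): under the same
hypotheses, `x/φ(q) − x/(5 log² x) − 1.001 √x ≤ θ(x; q, a)`.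
[cite: BennettMartinOBryantRechnitzer2018, Lemmas 6.12 and 6.14] -/
theorem theta_lower_bound_of_noExceptionalZeroUpTo (h612 : lemma612_theta) {Q : ℕ} {c₀ : ℝ}
    (hN : NoExceptionalZeroUpTo Q c₀) (hc : 1 / R₁ ≤ c₀) {q : ℕ} [NeZero q] (hq : 10 ^ 5 ≤ q)
    (hqQ : q ≤ Q) (a : (ZMod q)ˣ) {x : ℝ} (hx : Real.exp (4 * R₁ * Real.log q ^ 2) ≤ x) :
    x / q.totient - x / (5 * Real.log x ^ 2) - 1.001 * Real.sqrt x ≤ thetaMod q (a : ZMod q) x := by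
  have h1 := theta_bound_of_noExceptionalZeroUpTo h612 hN hc hq hqQ a hx
  have h2 := errTerm_le_div_log_sq hq hx
  have h3 := (abs_le.1 h1).1
  linarith

/-! ### The least prime in a progression -/

/-- For `q ≥ 10⁵`: `e^{√q/2} > (3/2) q` (indeed `e^t ≥ t⁴/24` and `q²/384 > 3q/2` for `q > 576`).
[folklore] -/
private theorem three_halves_mul_lt_exp_sqrt_half {q : ℕ} (hq : 10 ^ 5 ≤ q) :
    3 / 2 * (q : ℝ) < Real.exp (Real.sqrt q / 2) := by
  have hq' : (10 : ℝ) ^ 5 ≤ q := by exact_mod_cast hq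
  have hq0 : (0 : ℝ) ≤ q := by linarith
  have hs : Real.sqrt q ^ 2 = q := Real.sq_sqrt hq0
  have ht0 : 0 ≤ Real.sqrt q / 2 := by positivity
  have h4 : (Real.sqrt q / 2) ^ 4 / (Nat.factorial 4) ≤ Real.exp (Real.sqrt q / 2) :=
    Real.pow_div_factorial_le_exp _ ht0 4
  have heq : (Real.sqrt q / 2) ^ 4 = (q : ℝ) ^ 2 / 16 := by
    rw [show (Real.sqrt q / 2) ^ 4 = (Real.sqrt q ^ 2) ^ 2 / 16 by ring, hs]
  rw [heq] at h4
  have hfac : (Nat.factorial 4 : ℝ) = 24 := by norm_num [Nat.factorial]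
  rw [hfac] at h4
  nlinarith

/-- **`θ(x; q, a) > 0` beyond `exp(max(4R₁ log² q, √q))`.** Under `lemma612_theta` and a table
`NoExceptionalZeroUpTo Q c₀` with `1/R₁ ≤ c₀`: for every modulus `10⁵ ≤ q ≤ Q`, every unit `a` mod `q`
and every `x` with `4R₁ log² q ≤ log x` and `√q ≤ log x`, `θ(x; q, a) > 0`. (From the lower bound:
`log² x ≥ q ≥ φ(q)` gives `x/(5 log² x) ≤ x/(5 φ(q))`, and `1.001 √x < (4/5) x/φ(q)` since
`√x ≥ e^{√q/2} > (3/2) q`.) [cite: BennettMartinOBryantRechnitzer2018, Lemmas 6.12 and 6.14] -/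
theorem theta_pos_of_noExceptionalZeroUpTo (h612 : lemma612_theta) {Q : ℕ} {c₀ : ℝ}
    (hN : NoExceptionalZeroUpTo Q c₀) (hc : 1 / R₁ ≤ c₀) {q : ℕ} [NeZero q] (hq : 10 ^ 5 ≤ q)
    (hqQ : q ≤ Q) (a : (ZMod q)ˣ) {x : ℝ} (hx : Real.exp (4 * R₁ * Real.log q ^ 2) ≤ x)
    (hx' : Real.sqrt q ≤ Real.log x) : 0 < thetaMod q (a : ZMod q) x := by
  have hlow := theta_lower_bound_of_noExceptionalZeroUpTo h612 hN hc hq hqQ a hx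
  have hx0 : 0 < x := (Real.exp_pos _).trans_le hx
  have hq' : (10 : ℝ) ^ 5 ≤ q := by exact_mod_cast hq
  have hq0 : (0 : ℝ) < q := by linarith
  have hφ0 : (0 : ℝ) < q.totient := by exact_mod_cast Nat.totient_pos.2 (NeZero.pos q)
  have hφq : (q.totient : ℝ) ≤ q := by exact_mod_cast Nat.totient_le q
  -- `log² x ≥ q ≥ φ(q)`, so `x/(5 log² x) ≤ x/(5 φ(q))`
  have hsq : Real.sqrt q ^ 2 = q := Real.sq_sqrt hq0.le
  have hlog2 : (q : ℝ) ≤ Real.log x ^ 2 := by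
    rw [← hsq]; exact pow_le_pow_left₀ (Real.sqrt_nonneg _) hx' 2
  have hlogx0 : 0 < Real.log x := lt_of_lt_of_le (Real.sqrt_pos.2 hq0) hx'
  have h1 : x / (5 * Real.log x ^ 2) ≤ x / (5 * q.totient) :=
    div_le_div_of_nonneg_left hx0.le (by positivity) (by linarith)
  -- `1.001 √x < (4/5) x / φ(q)`: `√x ≥ e^{√q/2} > 3q/2 ≥ 3φ(q)/2`
  have hsx : Real.exp (Real.sqrt q / 2) ≤ Real.sqrt x := by
    rw [Real.sqrt_eq_rpow x, Real.rpow_def_of_pos hx0, Real.exp_le_exp]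
    linarith
  have h32 := three_halves_mul_lt_exp_sqrt_half hq
  have hsx0 : 0 < Real.sqrt x := Real.sqrt_pos.2 hx0
  have hxx : Real.sqrt x * Real.sqrt x = x := Real.mul_self_sqrt hx0.le
  have hA : 1.001 * (q.totient : ℝ) < 4 / 5 * Real.sqrt x := by linarith
  have hB : 1.001 * Real.sqrt x * q.totient < 4 / 5 * x := by
    have := mul_lt_mul_of_pos_right hA hsx0
    calc 1.001 * Real.sqrt x * q.totient = 1.001 * (q.totient : ℝ) * Real.sqrt x := by ring
      _ < 4 / 5 * Real.sqrt x * Real.sqrt x := this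
      _ = 4 / 5 * x := by rw [mul_assoc, hxx]
  have h2 : 1.001 * Real.sqrt x < 4 / 5 * (x / q.totient) := by
    rw [show 4 / 5 * (x / (q.totient : ℝ)) = (4 / 5 * x) / q.totient by ring, lt_div_iff₀ hφ0]
    exact hB
  have h3 : x / (5 * q.totient) = 1 / 5 * (x / q.totient) := by
    field_simp
  linarith

/-- **Nat-floor form**: `θ(x; q, a) > 0` forces a prime `p ≤ x` with `p ≡ a (mod q)` (a positive sum of
the non-negative terms `log n · 1_{n prime, n ≡ a}` over `n ≤ ⌊x⌋` has a non-zero term). [folklore] -/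
private theorem exists_prime_of_thetaMod_pos {q : ℕ} (a : ZMod q) {x : ℝ} (h : 0 < thetaMod q a x) :
    ∃ p : ℕ, p.Prime ∧ (p : ZMod q) = a ∧ (p : ℝ) ≤ x := by
  by_contra hne
  push Not at hne
  have hx0 : 0 ≤ x := by
    by_contra hx
    push Not at hx
    have : thetaMod q a x = 0 := by
      unfold thetaMod
      rw [Nat.floor_of_nonpos hx.le]
      simp [primeInd]
    linarith
  have hzero : thetaMod q a x = 0 := by
    unfold thetaMod
    refine sum_eq_zero fun n hn ↦ ?_
    unfold primeInd
    split_ifs with hpa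
    · exfalso
      have hnx : (n : ℝ) ≤ x := by
        have := (mem_Icc.1 hn).2
        exact (Nat.cast_le.2 this).trans (Nat.floor_le hx0)
      exact absurd hnx (not_le.2 (hne n hpa.2 hpa.1))
    · simp
  linarith

/-- **The least prime in a progression to a non-exceptional modulus, explicitly.** Under the named fact
`lemma612_theta` and a table `NoExceptionalZeroUpTo Q c₀` with `1/R₁ ≤ c₀`: for every modulus
`10⁵ ≤ q ≤ Q` and every reduced class `a` mod `q` there is a prime `p ≡ a (mod q)` with
`p ≤ exp(max(4R₁ log² q, √q))` (`4R₁ = 38.583635204`). NOT Linnik's `q^L`: the size is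
`exp(O(log² q + √q))`. [cite: BennettMartinOBryantRechnitzer2018, Lemmas 6.12 and 6.14] -/
theorem exists_prime_le_of_noExceptionalZeroUpTo (h612 : lemma612_theta) {Q : ℕ} {c₀ : ℝ}
    (hN : NoExceptionalZeroUpTo Q c₀) (hc : 1 / R₁ ≤ c₀) {q : ℕ} [NeZero q] (hq : 10 ^ 5 ≤ q)
    (hqQ : q ≤ Q) (a : (ZMod q)ˣ) :
    ∃ p : ℕ, p.Prime ∧ (p : ZMod q) = a ∧
      (p : ℝ) ≤ Real.exp (max (4 * R₁ * Real.log q ^ 2) (Real.sqrt q)) := by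
  refine exists_prime_of_thetaMod_pos (a : ZMod q)
    (theta_pos_of_noExceptionalZeroUpTo h612 hN hc hq hqQ a ?_ ?_)
  · exact Real.exp_le_exp.2 (le_max_left _ _)
  · rw [Real.log_exp]; exact le_max_right _ _

/-- **Instance over Platt's range** (conditional on `platt2016_theorem71` and `lemma612_theta`): for every
modulus `10⁵ ≤ q ≤ 4·10⁵` and every reduced class `a` there is a prime `p ≡ a (mod q)` with
`p ≤ exp(max(4R₁ log² q, √q))`. [cite: BennettMartinOBryantRechnitzer2018, Proposition 6.18 (remark before)] -/
theorem exists_prime_le_platt (hP : platt2016_theorem71) (h612 : lemma612_theta) {q : ℕ} [NeZero q]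
    (hq : 10 ^ 5 ≤ q) (hqQ : q ≤ 400000) (a : (ZMod q)ˣ) :
    ∃ p : ℕ, p.Prime ∧ (p : ZMod q) = a ∧
      (p : ℝ) ≤ Real.exp (max (4 * R₁ * Real.log q ^ 2) (Real.sqrt q)) :=
  exists_prime_le_of_noExceptionalZeroUpTo h612 (noExceptionalZeroUpTo_platt hP)
    (by unfold R₁; norm_num) hq hqQ a

end BMOR2018

end Literature.NumberTheory.LFunctions

end
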